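import Mathlib
import Literature.Analysis.FluidPDE.VectorCalculus
import Literature.Analysis.FluidPDE.LeiZhang2011Proofs
import Summits.NavierStokesRegularity.NavierStokesRegularity.Theorems.FilamentSkeletonRssSkeletonEquilibriumSelfInductionTail

/-!
# Route `FilamentSkeletonRss` · crux `SelectionBoxRJ` (stmt-NavierStokesRegularity-21220) — rung tools:
# the near-straight refinement of the `e`-uniform tail bound for the self-induction integral

Lane `ns-filament-19175-p1` (g6); nonlocal brick (N1) of the memo `SIGMA-SCALING-21220.md` (item evidence #18).
Helper file `--supports stmt-NavierStokesRegularity-21220`; route-independent (no `Theses` import).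

The tree's local-induction layer for the Rosenhead-regularised self-induction
`S_e[X](t) = ∫ K_e(X t − X u) • X′(u) × (X t − X u) du`, `K_e(r) = (‖r‖² + e²)^{-3/2}`, splits `ℝ` into the window
`|u − t| < δ` (`stub_liaWindowAssembly`: `Λ_e • X′ × X″ + O(δ(H + κ₀²))`) and the tail `|u − t| ≥ δ`, bounded crudely and
uniformly by `2/(c²δ)` for a chord-arc curve (`stub_selfInductionTail`).  For the in-ball arcs of the box (nearly straight:
the total bending angle is `≤ 2πRb²/γ` uniformly in `Γ`, memo §2) the crude tail bound is the only `O(1)` term left in the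
remainder; this file removes it:

* `nearStraight_selfInductionTail` — if moreover the unit tangent stays within `θ` of a fixed vector `a` with `‖a‖ ≤ 1`,
  `‖X′(u) − a‖ ≤ θ` for all `u`, then the tail integral has norm at most `4θ/(c³δ)`.  Proof: write
  `X′(u) × (X t − X u) = (X′(u) − a) × (X t − X u) + a × ((X t − t a) − (X u − u a))` (`a × a = 0`); both summands are
  `≤ θ|u − t|` by the mean value inequality (`‖X′‖ ≤ 1`, resp. `‖(X − (·) a)′‖ = ‖X′ − a‖ ≤ θ`), and
  `K_e(r) ≤ r⁻³ ≤ (c|u − t|)⁻³`; the majorant `(2θ/c³)(u − t)⁻²` integrates to `4θ/(c³δ)` over the tail.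

So for a straight line (`θ = 0`) the tail vanishes, and for the box's in-ball arcs continued by straight rays the whole
beyond-LIA self-remainder is `O(θ + δ(H + κ₀²))` with `θ = O(Rb²)`, `H, κ₀ = O(1/log Γ)` — the forced local-induction
model of `…SelectionBoxRJRungSlipLaw` is the true skeleton equation up to that error (memo §5, N1).

HONEST FRAMING.  A kernel estimate for the rung ladder of a HYPOTHETICAL filament box; nothing here is a claim about
Navier–Stokes regularity or blow-up.
-/

set_option linter.dupNamespace false

noncomputable section

namespace Summit.NavierStokesRegularity.NavierStokesRegularity.Theorems

open Set Function Filter MeasureTheory Real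
open Literature.Analysis.FluidPDE
open scoped InnerProductSpace Topology

namespace SelectionBoxRJRung

/-- The scaled inverse-square majorant on the translated symmetric tail: for `0 < δ` and any constant `C`,
`u ↦ C ((u − t)²)⁻¹` is integrable on `{u | δ ≤ |u − t|}` with integral `2C/δ`. [folklore] -/
private theorem nst_majorant_tail (C t : ℝ) {δ : ℝ} (hδ : 0 < δ) :
    IntegrableOn (fun u : ℝ => C * ((u - t) ^ 2)⁻¹) {u : ℝ | δ ≤ |u - t|} ∧
      ∫ u in {u : ℝ | δ ≤ |u - t|}, C * ((u - t) ^ 2)⁻¹ = 2 * C / δ := by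
  -- adapted from the private helpers of FilamentSkeletonRssSkeletonEquilibriumSelfInductionTail
  have hIoi : ∫ v in Ioi δ, (v ^ 2)⁻¹ = δ⁻¹ := by
    calc ∫ v in Ioi δ, (v ^ 2)⁻¹ = ∫ v in Ioi δ, v ^ (-2 : ℝ) := by
          refine setIntegral_congr_fun measurableSet_Ioi fun v hv => ?_
          have hv0 : 0 ≤ v := (hδ.trans hv).le
          rw [Real.rpow_neg hv0, Real.rpow_two]
      _ = δ⁻¹ := by
          rw [integral_Ioi_rpow_of_lt (by norm_num) hδ, show (-2 : ℝ) + 1 = -1 by norm_num,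
            Real.rpow_neg_one]
          ring
  have hIic : ∫ v in Iic (-δ), (v ^ 2)⁻¹ = δ⁻¹ := by
    have h := integral_comp_neg_Iic (-δ) (fun v : ℝ => (v ^ 2)⁻¹)
    simp only [neg_sq, neg_neg] at h
    rw [h, hIoi]
  have hIci : ∫ v in Ici δ, (v ^ 2)⁻¹ = δ⁻¹ := by
    rw [integral_Ici_eq_integral_Ioi, hIoi]
  have hne : (δ⁻¹ : ℝ) ≠ 0 := (inv_pos.2 hδ).ne'
  have hint1 : IntegrableOn (fun v : ℝ => (v ^ 2)⁻¹) (Iic (-δ)) :=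
    Integrable.of_integral_ne_zero (by rw [hIic]; exact hne)
  have hint2 : IntegrableOn (fun v : ℝ => (v ^ 2)⁻¹) (Ici δ) :=
    Integrable.of_integral_ne_zero (by rw [hIci]; exact hne)
  have hdisj : Disjoint (Iic (-δ)) (Ici δ) :=
    Set.disjoint_left.2 fun v hv1 hv2 => by
      simp only [mem_Iic, mem_Ici] at hv1 hv2
      linarith
  have htail : {v : ℝ | δ ≤ |v|} = Iic (-δ) ∪ Ici δ := by
    ext v
    simp only [mem_setOf_eq, mem_union, mem_Iic, mem_Ici, le_abs']
  have hint0 : IntegrableOn (fun v : ℝ => (v ^ 2)⁻¹) {v : ℝ | δ ≤ |v|} := by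
    rw [htail]; exact hint1.union hint2
  have hval0 : ∫ v in {v : ℝ | δ ≤ |v|}, (v ^ 2)⁻¹ = 2 * δ⁻¹ := by
    rw [htail, setIntegral_union hdisj measurableSet_Ici hint1 hint2, hIic, hIci]
    ring
  -- translate by `t`
  have hmp : MeasurePreserving (fun u : ℝ => u - t) volume volume := measurePreserving_sub_right volume t
  have hme : MeasurableEmbedding (fun u : ℝ => u - t) := measurableEmbedding_subRight t
  have hint' : IntegrableOn (fun u : ℝ => ((u - t) ^ 2)⁻¹) {u : ℝ | δ ≤ |u - t|} :=
    (hmp.integrableOn_comp_preimage hme).2 hint0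
  have hval' : ∫ u in {u : ℝ | δ ≤ |u - t|}, ((u - t) ^ 2)⁻¹ = 2 * δ⁻¹ := by
    rw [← hval0]
    exact hmp.setIntegral_preimage_emb hme (fun v : ℝ => (v ^ 2)⁻¹) {v : ℝ | δ ≤ |v|}
  refine ⟨hint'.const_mul _, ?_⟩
  rw [integral_const_mul, hval']
  field_simp

/-- **Pointwise geometry of a near-straight chord.** If `X` is `C¹` with `‖X′‖ ≤ 1` and its velocity stays within
`θ` of a fixed vector `a` with `‖a‖ ≤ 1`, then `‖X′(u) × (X t − X u)‖ ≤ 2θ|u − t|` for all `t, u`: split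
`X′(u) = (X′(u) − a) + a` and `X t − X u = ((X t − t a) − (X u − u a)) + (t − u) a`, use `a × a = 0` and the mean
value inequality twice. [folklore] -/
theorem norm_cross_chord_le_of_nearStraight {X : ℝ → EuclideanSpace ℝ (Fin 3)}
    {a : EuclideanSpace ℝ (Fin 3)} {θ : ℝ} (hX : ContDiff ℝ 1 X) (hdX : ∀ u, ‖deriv X u‖ ≤ 1)
    (ha : ‖a‖ ≤ 1) (hθ : ∀ u, ‖deriv X u - a‖ ≤ θ) (t u : ℝ) :
    ‖cross (deriv X u) (X t - X u)‖ ≤ 2 * θ * |u - t| := by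
  have hXd : Differentiable ℝ X := hX.differentiable (by norm_num)
  have hθ0 : 0 ≤ θ := (norm_nonneg _).trans (hθ u)
  -- mean value inequality for `X`
  have hmv1 : ‖X t - X u‖ ≤ |u - t| := by
    have h := Convex.norm_image_sub_le_of_norm_deriv_le (f := X) (fun v _ => hXd v) (fun v _ => hdX v)
      convex_univ (mem_univ u) (mem_univ t)
    rw [one_mul] at h
    calc ‖X t - X u‖ ≤ ‖t - u‖ := h
      _ = |u - t| := by rw [Real.norm_eq_abs, abs_sub_comm]
  -- mean value inequality for `v ↦ X v − v • a`
  have hfd : ∀ v, HasDerivAt (fun v : ℝ => X v - v • a) (deriv X v - a) v := by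
    intro v
    have h1 : HasDerivAt (fun v : ℝ => v • a) ((1 : ℝ) • a) v := (hasDerivAt_id v).smul_const a
    rw [one_smul] at h1
    exact (hXd v).hasDerivAt.sub h1
  have hmv2 : ‖(X t - t • a) - (X u - u • a)‖ ≤ θ * |u - t| := by
    have h := Convex.norm_image_sub_le_of_norm_deriv_le (f := fun v : ℝ => X v - v • a)
      (fun v _ => (hfd v).differentiableAt) (fun v _ => by rw [(hfd v).deriv]; exact hθ v)
      convex_univ (mem_univ u) (mem_univ t)
    calc ‖(X t - t • a) - (X u - u • a)‖ ≤ θ * ‖t - u‖ := h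
      _ = θ * |u - t| := by rw [Real.norm_eq_abs, abs_sub_comm]
  -- algebra of the split
  have hsplit : cross (deriv X u) (X t - X u) =
      cross (deriv X u - a) (X t - X u) + cross a ((X t - t • a) - (X u - u • a)) := by
    ext i
    fin_cases i <;> simp [cross, crossProduct] <;> ring
  rw [hsplit]
  calc ‖cross (deriv X u - a) (X t - X u) + cross a ((X t - t • a) - (X u - u • a))‖
      ≤ ‖cross (deriv X u - a) (X t - X u)‖ + ‖cross a ((X t - t • a) - (X u - u • a))‖ := norm_add_le _ _
    _ ≤ ‖deriv X u - a‖ * ‖X t - X u‖ + ‖a‖ * ‖(X t - t • a) - (X u - u • a)‖ :=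
        add_le_add (norm_cross_le_norm_mul_norm _ _) (norm_cross_le_norm_mul_norm _ _)
    _ ≤ θ * |u - t| + 1 * (θ * |u - t|) := by
        gcongr
        · exact hθ u
    _ = 2 * θ * |u - t| := by ring

/-- **Near-straight refinement of the `e`-uniform tail bound** (`stub_selfInductionTail` gains the factor `2θ/c`).
For `c > 0`, `δ > 0`, a `C¹` curve `X : ℝ → ℝ³` with `‖X′‖ ≤ 1`, chord-arc from `t` (`c|u − t| ≤ ‖X u − X t‖`) and
near-straight (`‖X′(u) − a‖ ≤ θ` for a fixed `a`, `‖a‖ ≤ 1`), the regularised Biot–Savart self-induction integrand is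
integrable on the tail `{u | δ ≤ |u − t|}` and its integral there has norm at most `4θ/(c³δ)`, uniformly in the core
parameter `e ≠ 0` (pointwise majorant `(2θ/c³)(u − t)⁻²`). [folklore] -/
theorem nearStraight_selfInductionTail :
    ∀ (e c δ θ : ℝ) (X : ℝ → EuclideanSpace ℝ (Fin 3)) (a : EuclideanSpace ℝ (Fin 3)) (t : ℝ), e ≠ 0 → 0 < c →
      0 < δ → ‖a‖ ≤ 1 → ContDiff ℝ 1 X → (∀ u, ‖deriv X u‖ ≤ 1) → (∀ u, ‖deriv X u - a‖ ≤ θ) →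
      (∀ u, c * |u - t| ≤ ‖X u - X t‖) →
      IntegrableOn (fun u : ℝ => ((‖X t - X u‖ ^ 2 + e ^ 2) ^ (3 / 2 : ℝ))⁻¹ • cross (deriv X u) (X t - X u))
        {u : ℝ | δ ≤ |u - t|} ∧
      ‖∫ u in {u : ℝ | δ ≤ |u - t|}, ((‖X t - X u‖ ^ 2 + e ^ 2) ^ (3 / 2 : ℝ))⁻¹ • cross (deriv X u) (X t - X u)‖
        ≤ 4 * θ / (c ^ 3 * δ) := by
  intro e c δ θ X a t he hc hδ ha hX hdX hθ hchord
  -- integrability from the crude tail lemma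
  obtain ⟨hint, -⟩ := SkeletonEquilibrium.Sketch.stub_selfInductionTail e c δ X t he hc hδ hX hdX hchord
  refine ⟨hint, ?_⟩
  have hθ0 : 0 ≤ θ := (norm_nonneg _).trans (hθ t)
  have hSm : MeasurableSet {u : ℝ | δ ≤ |u - t|} :=
    (isClosed_le continuous_const (continuous_abs.comp (continuous_id.sub continuous_const))).measurableSet
  obtain ⟨hg_int, hg_val⟩ := nst_majorant_tail (2 * θ / c ^ 3) t hδ
  have hb : ∀ u : ℝ, 0 < ‖X t - X u‖ ^ 2 + e ^ 2 := fun u => by positivity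
  -- pointwise bound on the tail
  have hbound : ∀ u ∈ {u : ℝ | δ ≤ |u - t|},
      ‖((‖X t - X u‖ ^ 2 + e ^ 2) ^ (3 / 2 : ℝ))⁻¹ • cross (deriv X u) (X t - X u)‖
        ≤ 2 * θ / c ^ 3 * ((u - t) ^ 2)⁻¹ := by
    intro u hu
    simp only [mem_setOf_eq] at hu
    have hut : 0 < |u - t| := lt_of_lt_of_le hδ hu
    have hcu : 0 < c * |u - t| := mul_pos hc hut
    have hr : c * |u - t| ≤ ‖X t - X u‖ := by rw [norm_sub_rev]; exact hchord u
    have hrpos : 0 < ‖X t - X u‖ := lt_of_lt_of_le hcu hr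
    -- kernel bound `K_e(r) ≤ (c|u-t|)⁻³`
    have hK : ((‖X t - X u‖ ^ 2 + e ^ 2) ^ (3 / 2 : ℝ))⁻¹ ≤ ((c * |u - t|) ^ 3)⁻¹ := by
      have h1 : (c * |u - t|) ^ 3 ≤ ‖X t - X u‖ ^ 3 := pow_le_pow_left₀ hcu.le hr 3
      have h2 : ‖X t - X u‖ ^ 3 ≤ (‖X t - X u‖ ^ 2 + e ^ 2) ^ (3 / 2 : ℝ) := by
        have h3 : (‖X t - X u‖ ^ 2) ^ (3 / 2 : ℝ) ≤ (‖X t - X u‖ ^ 2 + e ^ 2) ^ (3 / 2 : ℝ) :=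
          Real.rpow_le_rpow (sq_nonneg _) (le_add_of_nonneg_right (sq_nonneg e)) (by norm_num)
        have h4 : (‖X t - X u‖ ^ 2) ^ (3 / 2 : ℝ) = ‖X t - X u‖ ^ 3 := by
          rw [← Real.rpow_natCast (‖X t - X u‖) 2, ← Real.rpow_mul (norm_nonneg _)]
          norm_num
        rw [h4] at h3
        exact h3
      exact inv_anti₀ (pow_pos hcu 3) (h1.trans h2)
    have hcross := norm_cross_chord_le_of_nearStraight hX hdX ha hθ t u
    rw [norm_smul, norm_inv, Real.norm_of_nonneg (Real.rpow_nonneg (hb u).le _)]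
    calc ((‖X t - X u‖ ^ 2 + e ^ 2) ^ (3 / 2 : ℝ))⁻¹ * ‖cross (deriv X u) (X t - X u)‖
        ≤ ((c * |u - t|) ^ 3)⁻¹ * (2 * θ * |u - t|) :=
          mul_le_mul hK hcross (norm_nonneg _) (inv_nonneg.2 (pow_nonneg hcu.le 3))
      _ = 2 * θ / c ^ 3 * ((u - t) ^ 2)⁻¹ := by
          have hne : |u - t| ≠ 0 := hut.ne'
          rw [← sq_abs (u - t)]
          field_simp
  have hae : ∀ᵐ u ∂(volume.restrict {u : ℝ | δ ≤ |u - t|}),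
      ‖((‖X t - X u‖ ^ 2 + e ^ 2) ^ (3 / 2 : ℝ))⁻¹ • cross (deriv X u) (X t - X u)‖
        ≤ 2 * θ / c ^ 3 * ((u - t) ^ 2)⁻¹ :=
    (ae_restrict_iff' hSm).2 (Eventually.of_forall hbound)
  calc ‖∫ u in {u : ℝ | δ ≤ |u - t|},
          ((‖X t - X u‖ ^ 2 + e ^ 2) ^ (3 / 2 : ℝ))⁻¹ • cross (deriv X u) (X t - X u)‖
      ≤ ∫ u in {u : ℝ | δ ≤ |u - t|}, 2 * θ / c ^ 3 * ((u - t) ^ 2)⁻¹ :=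
        norm_integral_le_of_norm_le hg_int hae
    _ = 2 * (2 * θ / c ^ 3) / δ := hg_val
    _ = 4 * θ / (c ^ 3 * δ) := by
        field_simp
        ring

end SelectionBoxRJRung

end Summit.NavierStokesRegularity.NavierStokesRegularity.Theorems
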